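import Mathlib
import HarnessLib
import Summits.HubbardSuperconductivity.HubbardSuperconductivity.Theorems.ChiralWindowCwKLChiralWindowChannelBoundR
import Summits.HubbardSuperconductivity.HubbardSuperconductivity.Theorems.ChiralWindowCwKLChiralWindowChannelFar
import Summits.HubbardSuperconductivity.HubbardSuperconductivity.Theorems.ChiralWindowCwKLChiralWindowCertTrig
import Summits.HubbardSuperconductivity.HubbardSuperconductivity.Theorems.ChiralWindowDefsResidual
import Summits.HubbardSuperconductivity.HubbardSuperconductivity.Theorems.ChiralWindowCwKLChiralWindowBlockBounds

/-!
# Crux `CwKLChiralWindow` (stmt-1741), line `Sketch`: block-level Ritz/Temple/far-channel bounds, residual form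

`stub_klBlockBoundsR`: the residual-form variant of `stub_klBlockBounds`
(`Theorems/ChiralWindowCwKLChiralWindowBlockBounds.lean`).  For a channel block `b : KLBlock` of the certificate record
with its RESIDUAL-FORM enclosures `b.EnclosureR tab μ χ` at a level `μ ∈ (-4,0)` (`Theorems/ChiralWindowDefsResidual.lean`:
the trial conjunct bounds the residual integral `∫ (F - s·Φ)² ≤ Thi` instead of the image norm `∫ F² ≤ Thi`), the
checker's rational bounds are sound: if `b.lowerOKR tab χ` then `b.lowerR tab χ ≤ channelInf ε₀ μ 1 χ`, and if
`b.templeOKR tab χ` in the equality case `withU ∨ χ ≠ A1g` then `channelInf ε₀ μ 1 χ ≤ b.upper`.  The proof only UNPACKS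
the record, exactly as in the `α`-form file whose dictionary lemmas (`kl_bkb_arith`, `kl_bkb_deflKernel_eq`,
`kl_bkb_sqmass_eq`, `kl_bkb_defl_nonneg`, `kl_bkb_withU`) and far-channel bound (`kl_bkb_far`) are reused: on a trial
block (`useTrial = true`) the Boolean `templeOKR` gives the rational side conditions, the enclosures give the real
inequalities, and the landed abstract residual-form bound `stub_klChannelBoundR` (Ritz/Temple with the residual
`‖(A - s)Φ̂‖² ≤ ẽ`) is instantiated with `Φ = b.trialFun tab`, `ρlo = b.rholo`, `ρhi = b.rhohi`, `ẽ = b.etil`, `h = b.Hhi`,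
`β = b.beta`, `s = b.s` (`kl_bkbr_temple`); on a block without trial (`useTrial = false`) the `α`-form enclosure
`b.Enclosure tab μ χ` holds trivially from `b.EnclosureR tab μ χ` and `kl_bkb_far` applies verbatim.
-/

noncomputable section

set_option linter.dupNamespace false

namespace Summit.HubbardSuperconductivity.HubbardSuperconductivity.Theorems

open MeasureTheory Literature.MathematicalPhysics.QuantumLattice CwKLChiralWindow

/-! ### The residual-form Temple bound, instantiated with the block data -/

/-- **Temple/Ritz bounds of a block, residual form.** If the checker accepts the residual-form Temple data of the block
(`templeOKR`) and the residual-form block enclosures hold at `μ`, then `min (g ρlo) (g ρhi) ≤ channelInf ε₀ μ 1 χ` with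
`g ρ = (β ρ - ρ² - ẽ)/(β - ρ)` (all data the block's rationals `rholo, rhohi, etil, beta`), and in the equality case
`withU ∨ χ ≠ A1g` also `channelInf ε₀ μ 1 χ ≤ ρhi`: `stub_klChannelBoundR` with the block's trial `b.trialFun tab`, shift
`b.s` and deflation list; the residual enclosure `∫ (F - s·Φ)² ≤ Thi` is normalised to `≤ (Thi/Nlo) · ∫ Φ²` by
`kl_bkb_arith`. [folklore] -/
theorem kl_bkbr_temple {μ : ℝ} (hμ : μ ∈ Set.Ioo (-4 : ℝ) 0) (b : KLBlock) (tab : List KLTrig) (χ : D4Irrep)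
    (hT : b.templeOKR tab χ = true) (hE : b.EnclosureR tab μ χ) :
    min (((b.beta : ℝ) * (b.rholo : ℝ) - (b.rholo : ℝ) ^ 2 - (b.etil : ℝ)) / ((b.beta : ℝ) - (b.rholo : ℝ)))
        (((b.beta : ℝ) * (b.rhohi : ℝ) - (b.rhohi : ℝ) ^ 2 - (b.etil : ℝ)) / ((b.beta : ℝ) - (b.rhohi : ℝ))) ≤
      channelInf (squareDispersion 1 0) μ 1 χ ∧
    ((b.withU = true ∨ χ ≠ D4Irrep.A1g) → channelInf (squareDispersion 1 0) μ 1 χ ≤ (b.rhohi : ℝ)) := by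
  have hT' := hT
  simp only [KLBlock.templeOKR, KLBlock.ritzOK, Bool.and_eq_true, decide_eq_true_eq] at hT'
  obtain ⟨⟨⟨⟨⟨⟨⟨⟨⟨⟨⟨⟨hut, -⟩, hfits⟩, hNlo⟩, -⟩, -⟩, hQhi⟩, hwu⟩, hdefl⟩, hThi⟩, hβ0⟩, hHβ⟩, hρβ⟩ := hT'
  obtain ⟨hE1, hE2⟩ := hE
  obtain ⟨h1, h2, h3, h4, h5⟩ := hE1 hut
  simp only [KLBlock.baseKernel] at h3 h4 h5
  obtain ⟨hN, hρlo, hρhi, hρhi0, het⟩ :=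
    kl_bkb_arith (by exact_mod_cast hNlo) (by exact_mod_cast hQhi) (by exact_mod_cast hThi) h1 h2 h3 h4 h5
  have hrholo : ((b.rholo : ℚ) : ℝ) = min ((b.Qlo : ℝ) / (b.Nlo : ℝ)) ((b.Qlo : ℝ) / (b.Nhi : ℝ)) := by
    push_cast [KLBlock.rholo]; rfl
  have hrhohi : ((b.rhohi : ℚ) : ℝ) = max ((b.Qhi : ℝ) / (b.Nlo : ℝ)) ((b.Qhi : ℝ) / (b.Nhi : ℝ)) := by
    push_cast [KLBlock.rhohi]; rfl
  have hetil : ((b.etil : ℚ) : ℝ) = (b.Thi : ℝ) / (b.Nlo : ℝ) := by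
    push_cast [KLBlock.etil]; rfl
  rw [← hrholo] at hρlo
  rw [← hrhohi] at hρhi hρhi0
  rw [← hetil] at het
  have hβ : (b.Hhi : ℝ) - (if χ = D4Irrep.E then 2 else 1) * (b.rhohi : ℝ) ^ 2 ≤ (b.beta : ℝ) ^ 2 := by
    have h := (Rat.cast_le (K := ℝ)).2 hHβ
    unfold KLBlock.dmult at h
    split_ifs at h ⊢ <;> push_cast at h <;> linarith
  exact stub_klChannelBoundR μ hμ χ b.withU b.defl.length (fun m => ((b.defl[(m : ℕ)].1 : ℚ) : ℝ))
    (fun m => (klTab tab b.defl[(m : ℕ)].2).toFun) (b.trialFun tab) (b.rholo : ℝ) (b.rhohi : ℝ) (b.etil : ℝ)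
    (b.Hhi : ℝ) (b.beta : ℝ) (b.s : ℝ) (kl_bkb_withU hwu) (kl_bkb_defl_nonneg hdefl) (fun m => kl_tr_toFun_memLp _ hμ)
    (kl_tr_toFun_memLp (klTab tab b.trial) hμ) (stub_klTrigChannel (klTab tab b.trial) χ hfits) hN hρlo hρhi hρhi0
    het ((kl_bkb_sqmass_eq b tab μ χ).trans_le hE2) (by exact_mod_cast hβ0) hβ (by exact_mod_cast hρβ)

/-! ### The stub -/

/-- **Block-level soundness of the checker's bounds, residual form** (`stub_klBlockBoundsR`): for a block `b` with its
residual-form enclosures at the level `μ ∈ (-4,0)` in the channel `χ`: if the checker certifies a lower bound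
(`lowerOKR`: residual Temple data on a trial block, far-channel data on a block without trial) then
`b.lowerR tab χ ≤ channelInf ε₀ μ 1 χ` (`…ChannelBoundR` with the trial `Φ = b.trialFun tab`, `ρlo = b.rholo`,
`ρhi = b.rhohi`, `ẽ = b.etil`, `h = b.Hhi`, `β = b.beta`, shift `s = b.s` and the deflation of the block, or `…ChannelFar`
with `s = b.s`, the `α`-form enclosure being trivially available on a block without trial); if it accepts the residual
Temple data and the block is in the equality case (`withU ∨ χ ≠ A1g`) then `channelInf ε₀ μ 1 χ ≤ b.upper` (Ritz).
[folklore] -/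
theorem stub_klBlockBoundsR : ∀ μ ∈ Set.Ioo (-4 : ℝ) 0, ∀ (b : KLBlock) (tab : List KLTrig) (χ : D4Irrep),
    b.EnclosureR tab μ χ →
    (b.lowerOKR tab χ = true → ((b.lowerR tab χ : ℚ) : ℝ) ≤ channelInf (squareDispersion 1 0) μ 1 χ) ∧
    (b.templeOKR tab χ = true → (b.withU = true ∨ χ ≠ D4Irrep.A1g) →
      channelInf (squareDispersion 1 0) μ 1 χ ≤ ((b.upper : ℚ) : ℝ)) := by
  intro μ hμ b tab χ hE
  refine ⟨fun hL => ?_, fun hT hcase => (kl_bkbr_temple hμ b tab χ hT hE).2 hcase⟩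
  cases hut : b.useTrial with
  | true =>
    have hT : b.templeOKR tab χ = true := by simpa [KLBlock.lowerOKR, hut] using hL
    have h := (kl_bkbr_temple hμ b tab χ hT hE).1
    rw [KLBlock.lowerR, if_pos (by simp [hut, hT])]
    push_cast [KLBlock.templeR]
    exact h
  | false =>
    have hF : b.farOK tab χ = true := by simpa [KLBlock.lowerOKR, hut] using hL
    have hE' : b.Enclosure tab μ χ := ⟨fun h => absurd h (by simp [hut]), hE.2⟩
    simp only [KLBlock.lowerR, hut, Bool.false_and, Bool.false_eq_true, ↓reduceIte]
    push_cast
    exact kl_bkb_far hμ b tab χ hF hE'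

end Summit.HubbardSuperconductivity.HubbardSuperconductivity.Theorems

end
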